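import Literature.Computability.AlgebraicComplexity.SymmetricArithCircuit
import Mathlib.Algebra.MvPolynomial.CommRing
import Mathlib.Data.Fintype.Sum
import Mathlib.Data.Fintype.Prod
import Mathlib.Tactic.FinCases
import Mathlib.Tactic.Ring
import HarnessLib

/-!
# Symmetric circuits: subtracting the dense universal polynomial (the circuit)

Topic `Computability/AlgebraicComplexity`, namespace `Literature.Computability.AlgebraicComplexity`.

A standard manipulation of Dawar–Wilsenach symmetric arithmetic circuits
(`SymmetricArithCircuit.lean`: `LabelledArithCircuit` = Def. 2.2, `IsAutomorphismExtending` =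
Def. 3.6, `IsSymmetric` = Def. 3.7 of A. Dawar, G. Wilsenach, *Symmetric Arithmetic Circuits*,
Theory of Computing 21 (2025)), needed whenever Hrubeš's `ε`-sensitive monotonisation
(P. Hrubeš, *On ε-sensitive monotone computations*, Comput. Complexity 29 (2020), Thm. 1 and the
remark after it: "`f = (g_ε - U) ε⁻¹` has a small arithmetic circuit", `U = (1 + Σ_i x_i)^d`) is
combined with a lower bound for SYMMETRIC circuits: from a `Γ`-symmetric circuit `C` over a field
computing `U + e·p` (`e ≠ 0`) one obtains a `Γ`-symmetric circuit computing `p` with at most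
`|X| + d + 7` more gates, for ANY group `Γ` acting on the variables `X` (`U` is invariant under all
permutations of the variables and has an evidently symmetric circuit; symmetric circuits subtract).
This file builds the circuit (`LabelledArithCircuit.DenseSub.circuit`); semantics, symmetry, size
and the existence statement are in `SymmetricDenseSubtractionSymmetry.lean`.

Gates (`DenseSubGate`): the old gates of `C`; NEW input gates only for the variables and for the
constants `1, -1, e⁻¹` that have no input gate in `C` (Def. 2.2 demands injective labels on input
gates, so existing input gates are reused: `vsrc`, `csrc`); `d` addition gates `lin k`, each with
children "all variable sources and the source of `1`" (value `1 + Σ_x x`); a multiplication gate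
`pow` with children `{source of 1} ∪ {lin k}` (value `U`; the factor `1` keeps the gate non-nullary
when `d = 0`); `neg = pow × (-1)`, `dif = out_C + neg`, and the output `out = dif × e⁻¹`.
Everything is folklore and proved; nothing here is a named fact.
-/

noncomputable section

open scoped Classical

namespace Literature.Computability.AlgebraicComplexity

open MvPolynomial

universe u v w

/-! ### Gates -/

/-- Gates of the dense-subtraction circuit over a circuit with gate type `G`: the old gates, new
input gates for missing variables (`NV`) and missing constants (`NC`), `d` sum gates `lin k`
(each `1 + Σ_x x`), their product `pow`, `neg = pow × (-1)`, `dif = out_C + neg` and the output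
`out = dif × e⁻¹`. [folklore] -/
inductive DenseSubGate (G : Type w) (NV : Type v) (NC : Type u) (d : ℕ) : Type (max u v w)
  | old (g : G) : DenseSubGate G NV NC d
  | nvar (x : NV) : DenseSubGate G NV NC d
  | ncst (c : NC) : DenseSubGate G NV NC d
  | lin (k : Fin d) : DenseSubGate G NV NC d
  | pow : DenseSubGate G NV NC d
  | neg : DenseSubGate G NV NC d
  | dif : DenseSubGate G NV NC d
  | out : DenseSubGate G NV NC d

namespace DenseSubGate

variable {G : Type w} {NV : Type v} {NC : Type u} {d : ℕ}

/-- The gates as a sum type (for counting). [folklore] -/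
def equivSum : DenseSubGate G NV NC d ≃ G ⊕ NV ⊕ NC ⊕ Fin d ⊕ Fin 4 where
  toFun
    | old g => Sum.inl g
    | nvar x => Sum.inr (Sum.inl x)
    | ncst c => Sum.inr (Sum.inr (Sum.inl c))
    | lin k => Sum.inr (Sum.inr (Sum.inr (Sum.inl k)))
    | pow => Sum.inr (Sum.inr (Sum.inr (Sum.inr 0)))
    | neg => Sum.inr (Sum.inr (Sum.inr (Sum.inr 1)))
    | dif => Sum.inr (Sum.inr (Sum.inr (Sum.inr 2)))
    | out => Sum.inr (Sum.inr (Sum.inr (Sum.inr 3)))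
  invFun
    | Sum.inl g => old g
    | Sum.inr (Sum.inl x) => nvar x
    | Sum.inr (Sum.inr (Sum.inl c)) => ncst c
    | Sum.inr (Sum.inr (Sum.inr (Sum.inl k))) => lin k
    | Sum.inr (Sum.inr (Sum.inr (Sum.inr 0))) => pow
    | Sum.inr (Sum.inr (Sum.inr (Sum.inr 1))) => neg
    | Sum.inr (Sum.inr (Sum.inr (Sum.inr 2))) => dif
    | Sum.inr (Sum.inr (Sum.inr (Sum.inr 3))) => out
  left_inv g := by cases g <;> rfl
  right_inv t := by
    rcases t with g | x | c | k | k <;> [rfl; rfl; rfl; rfl; (fin_cases k <;> rfl)]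

/-- Finitely many gates over finitely many old gates, variables and constants. [folklore] -/
instance instFintype [Fintype G] [Fintype NV] [Fintype NC] : Fintype (DenseSubGate G NV NC d) :=
  Fintype.ofEquiv _ equivSum.symm

/-- `old` is injective. [folklore] -/
theorem old_injective : Function.Injective (old : G → DenseSubGate G NV NC d) := by
  intro a b h; cases h; rfl

/-- `lin` is injective. [folklore] -/
theorem lin_injective : Function.Injective (lin : Fin d → DenseSubGate G NV NC d) := by
  intro a b h; cases h; rfl

/-- `old` as an embedding (to map children sets). [folklore] -/
def oldEmb : G ↪ DenseSubGate G NV NC d := ⟨old, old_injective⟩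

/-- `oldEmb` is `old`. [folklore] -/
@[simp] theorem oldEmb_apply (g : G) : (oldEmb : G ↪ DenseSubGate G NV NC d) g = old g := rfl

/-- Relabelling the old gates by `π` and the new variable gates by `ρ`, fixing the rest.
[folklore] -/
def perm (π : Equiv.Perm G) (ρ : Equiv.Perm NV) : Equiv.Perm (DenseSubGate G NV NC d) where
  toFun
    | old g => old (π g)
    | nvar x => nvar (ρ x)
    | ncst c => ncst c
    | lin k => lin k
    | pow => pow
    | neg => neg
    | dif => dif
    | out => out
  invFun
    | old g => old (π.symm g)
    | nvar x => nvar (ρ.symm x)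
    | ncst c => ncst c
    | lin k => lin k
    | pow => pow
    | neg => neg
    | dif => dif
    | out => out
  left_inv g := by cases g <;> simp
  right_inv g := by cases g <;> simp

end DenseSubGate

/-! ### The construction -/

namespace LabelledArithCircuit

namespace DenseSub

variable {K : Type u} [Field K] {X : Type v} {G : Type w}
  (C : LabelledArithCircuit K X Unit G) (d : ℕ) (e : K)

/-- The constants used by the subtraction circuit: `1`, `-1`, `e⁻¹`. [folklore] -/
def cset : Finset K := {1, -1, e⁻¹}

/-- `1, -1, e⁻¹ ∈ cset e`. [folklore] -/
theorem mem_cset : (1 : K) ∈ cset e ∧ (-1 : K) ∈ cset e ∧ e⁻¹ ∈ cset e := by simp [cset]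

/-- The variables with no input gate in `C`. [folklore] -/
def NV : Type v := {x : X // ∀ g, C.label g ≠ .var x}

/-- The constants of `cset e` with no input gate in `C`. [folklore] -/
def NC : Type u := {c : K // c ∈ cset e ∧ ∀ g, C.label g ≠ .const c}

/-- `NV` is finite when `X` is. [folklore] -/
instance instFintypeNV [Fintype X] : Fintype (NV C) := by unfold NV; infer_instance

/-- `NC` is finite (a subset of `cset e`). [folklore] -/
instance instFintypeNC : Fintype (NC C e) :=
  Fintype.subtype ((cset e).filter fun c => ∀ g, C.label g ≠ .const c) (fun c => by
    simp [Finset.mem_filter])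

/-- The gate type of the subtraction circuit. [folklore] -/
abbrev Gate : Type (max u v w) := DenseSubGate G (NV C) (NC C e) d

variable {C d e}

/-- The gate sourcing the variable `x`: the old input gate labelled `x` if there is one, else the
new one. [folklore] -/
def vsrc (x : X) : Gate C d e :=
  if h : ∃ g, C.label g = .var x then .old h.choose else .nvar ⟨x, not_exists.mp h⟩

/-- The gate sourcing the constant `c ∈ cset e`: the old input gate labelled `c` if there is one,
else the new one. [folklore] -/
def csrc (c : K) (hc : c ∈ cset e) : Gate C d e :=
  if h : ∃ g, C.label g = .const c then .old h.choose else .ncst ⟨c, hc, not_exists.mp h⟩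

variable (C d e)

variable [Fintype X]

/-- Children in the subtraction circuit (module docstring). [folklore] -/
def children : Gate C d e → Finset (Gate C d e)
  | .old g => (C.children g).map DenseSubGate.oldEmb
  | .nvar _ => ∅
  | .ncst _ => ∅
  | .lin _ => insert (csrc 1 (mem_cset e).1) (Finset.univ.image vsrc)
  | .pow => insert (csrc 1 (mem_cset e).1) (Finset.univ.image DenseSubGate.lin)
  | .neg => {DenseSubGate.pow, csrc (-1) (mem_cset e).2.1}
  | .dif => {DenseSubGate.old (C.output ()), DenseSubGate.neg}
  | .out => {DenseSubGate.dif, csrc e⁻¹ (mem_cset e).2.2}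

omit [Fintype X] in
/-- Labels in the subtraction circuit. [folklore] -/
def label : Gate C d e → CircuitLabel K X
  | .old g => C.label g
  | .nvar x => .var x.1
  | .ncst c => .const c.1
  | .lin _ => .add
  | .pow => .mul
  | .neg => .mul
  | .dif => .add
  | .out => .mul

variable {C d e}

omit [Fintype X] in
/-- `vsrc x` is labelled `x`. [folklore] -/
theorem label_vsrc (x : X) : label C d e (vsrc x) = .var x := by
  unfold vsrc
  split_ifs with h
  · exact h.choose_spec
  · rfl

omit [Fintype X] in
/-- `csrc c` is labelled `c`. [folklore] -/
theorem label_csrc (c : K) (hc : c ∈ cset e) : label C d e (csrc c hc) = .const c := by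
  unfold csrc
  split_ifs with h
  · exact h.choose_spec
  · rfl

/-- `vsrc x` is an input gate. [folklore] -/
theorem children_vsrc (x : X) : children C d e (vsrc x) = ∅ := by
  unfold vsrc
  split_ifs with h
  · have h1 : (C.label h.choose).IsInput := by rw [h.choose_spec]; trivial
    simp [children, (C.isInput_iff _).1 h1]
  · rfl

/-- `csrc c` is an input gate. [folklore] -/
theorem children_csrc (c : K) (hc : c ∈ cset e) : children C d e (csrc c hc) = ∅ := by
  unfold csrc
  split_ifs with h
  · have h1 : (C.label h.choose).IsInput := by rw [h.choose_spec]; trivial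
    simp [children, (C.isInput_iff _).1 h1]
  · rfl

omit [Fintype X] in
/-- Distinct variables have distinct sources. [folklore] -/
theorem vsrc_injective : Function.Injective (vsrc : X → Gate C d e) := by
  intro x y hxy
  have h := congrArg (label C d e) hxy
  rw [label_vsrc, label_vsrc] at h
  cases h; rfl

omit [Fintype X] in
/-- A constant source is not a variable source. [folklore] -/
theorem csrc_ne_vsrc (c : K) (hc : c ∈ cset e) (x : X) :
    csrc c hc ≠ (vsrc x : Gate C d e) := by
  intro h
  have h' := congrArg (label C d e) h
  rw [label_csrc, label_vsrc] at h'
  cases h'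

omit [Fintype X] in
/-- A constant source is an old gate or a new constant gate; in particular it is none of the new
internal gates. [folklore] -/
theorem csrc_ne_of_ne (c : K) (hc : c ∈ cset e) {a : Gate C d e} (h1 : ∀ g, a ≠ .old g)
    (h2 : ∀ y, a ≠ .ncst y) : csrc c hc ≠ a := by
  unfold csrc
  split_ifs with h
  · exact (h1 _).symm
  · exact (h2 _).symm

/-! #### Acyclicity -/

/-- Old gates are accessible (acyclicity of `C`). [folklore] -/
theorem acc_old (g : G) : Acc (fun a b : Gate C d e => a ∈ children C d e b) (.old g) := by
  induction g using C.wf.induction with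
  | h g ih =>
    refine Acc.intro _ fun a ha => ?_
    simp only [children, Finset.mem_map, DenseSubGate.oldEmb_apply] at ha
    obtain ⟨h, hh, rfl⟩ := ha
    exact ih h hh

/-- Gates without children are accessible. [folklore] -/
theorem acc_of_children_eq_empty {a : Gate C d e} (h : children C d e a = ∅) :
    Acc (fun a b : Gate C d e => a ∈ children C d e b) a :=
  Acc.intro _ fun b hb => by simp [h] at hb

/-- The `lin` gates are accessible. [folklore] -/
theorem acc_lin (k : Fin d) : Acc (fun a b : Gate C d e => a ∈ children C d e b) (.lin k) := by
  refine Acc.intro _ fun a ha => ?_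
  simp only [children, Finset.mem_insert, Finset.mem_image, Finset.mem_univ, true_and] at ha
  rcases ha with rfl | ⟨x, rfl⟩
  · exact acc_of_children_eq_empty (children_csrc _ _)
  · exact acc_of_children_eq_empty (children_vsrc x)

/-- `pow` is accessible. [folklore] -/
theorem acc_pow : Acc (fun a b : Gate C d e => a ∈ children C d e b) .pow := by
  refine Acc.intro _ fun a ha => ?_
  simp only [children, Finset.mem_insert, Finset.mem_image, Finset.mem_univ, true_and] at ha
  rcases ha with rfl | ⟨k, rfl⟩
  · exact acc_of_children_eq_empty (children_csrc _ _)
  · exact acc_lin k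

/-- `neg` is accessible. [folklore] -/
theorem acc_neg : Acc (fun a b : Gate C d e => a ∈ children C d e b) .neg := by
  refine Acc.intro _ fun a ha => ?_
  simp only [children, Finset.mem_insert, Finset.mem_singleton] at ha
  rcases ha with rfl | rfl
  · exact acc_pow
  · exact acc_of_children_eq_empty (children_csrc _ _)

/-- `dif` is accessible. [folklore] -/
theorem acc_dif : Acc (fun a b : Gate C d e => a ∈ children C d e b) .dif := by
  refine Acc.intro _ fun a ha => ?_
  simp only [children, Finset.mem_insert, Finset.mem_singleton] at ha
  rcases ha with rfl | rfl
  · exact acc_old _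
  · exact acc_neg

/-- `out` is accessible. [folklore] -/
theorem acc_out : Acc (fun a b : Gate C d e => a ∈ children C d e b) .out := by
  refine Acc.intro _ fun a ha => ?_
  simp only [children, Finset.mem_insert, Finset.mem_singleton] at ha
  rcases ha with rfl | rfl
  · exact acc_dif
  · exact acc_of_children_eq_empty (children_csrc _ _)

/-- The child relation of the subtraction circuit is well founded. [folklore] -/
theorem wf : WellFounded fun a b : Gate C d e => a ∈ children C d e b :=
  ⟨fun a => by
    cases a with
    | old g => exact acc_old g
    | nvar x => exact acc_of_children_eq_empty rfl
    | ncst c => exact acc_of_children_eq_empty rfl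
    | lin k => exact acc_lin k
    | pow => exact acc_pow
    | neg => exact acc_neg
    | dif => exact acc_dif
    | out => exact acc_out⟩

/-! #### The labelled circuit -/

/-- Input labels exactly at the gates without children. [folklore] -/
theorem isInput_iff (a : Gate C d e) : (label C d e a).IsInput ↔ children C d e a = ∅ := by
  cases a with
  | old g => simp only [label, children, Finset.map_eq_empty]; exact C.isInput_iff g
  | nvar x => simp [label, children]
  | ncst c => simp [label, children]
  | lin k => simp [label, children, CircuitLabel.IsInput]
  | pow => simp [label, children, CircuitLabel.IsInput]
  | neg => simp [label, children, CircuitLabel.IsInput]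
  | dif => simp [label, children, CircuitLabel.IsInput]
  | out => simp [label, children, CircuitLabel.IsInput]

omit [Fintype X] in
/-- Labels are injective on input gates. [folklore] -/
theorem eq_of_label_eq (a b : Gate C d e) (ha : (label C d e a).IsInput)
    (hab : label C d e a = label C d e b) : a = b := by
  cases a with
  | old g =>
    change (C.label g).IsInput at ha
    cases b with
    | old g' => exact congrArg DenseSubGate.old (C.eq_of_label_eq g g' ha hab)
    | nvar x => exact absurd hab (x.2 g)
    | ncst c => exact absurd hab (c.2.2 g)
    | _ => simp only [label] at hab; rw [hab] at ha; exact absurd ha (by simp)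
  | nvar x =>
    cases b with
    | old g => exact absurd hab.symm (x.2 g)
    | nvar y =>
      simp only [label, CircuitLabel.var.injEq] at hab
      exact congrArg DenseSubGate.nvar (Subtype.ext hab)
    | _ => simp [label] at hab
  | ncst c =>
    cases b with
    | old g => exact absurd hab.symm (c.2.2 g)
    | ncst c' =>
      simp only [label, CircuitLabel.const.injEq] at hab
      exact congrArg DenseSubGate.ncst (Subtype.ext hab)
    | _ => simp [label] at hab
  | _ => exact absurd ha (by simp [label])

variable (C d e)

/-- **The dense-subtraction circuit** of `C` (module docstring): on top of `C`, the gates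
computing `U = (1 + Σ_x x)^d`, `-U`, `out_C - U` and the output `(out_C - U) · e⁻¹`. [folklore] -/
def circuit : LabelledArithCircuit K X Unit (Gate C d e) where
  children := children C d e
  label := label C d e
  output := fun _ => .out
  wf := wf
  isInput_iff := isInput_iff
  eq_of_label_eq := eq_of_label_eq
  output_injective := fun a b _ => Subsingleton.elim a b

end DenseSub

end LabelledArithCircuit

end Literature.Computability.AlgebraicComplexity

end
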